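import Summits.Ventures.PercRepro.RankLevelSetCoreSevenOfFormSplitKY
import Summits.Ventures.PercRepro.RankLevelSetCoreSevenOfForm
import Summits.Ventures.PercRepro.S1TriangleCountBootEight
import Summits.Ventures.PercRepro.S1TriangleBoundEightValuesA
import Summits.Ventures.PercRepro.S1CoreFourCircuitSum
import Summits.Ventures.PercRepro.S1CoreCapEightExactFinal
import Summits.Ventures.PercRepro.S1CoreCapEightExactChain
import Summits.Ventures.PercRepro.S1CoreCapEightExactChainB
import Summits.Ventures.PercRepro.S1FiveCircuitCountSharpC
import Summits.Ventures.PercRepro.RankLevelSetLevelSixRowsNineToFifteen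
import Summits.Ventures.PercRepro.S3SixWindow
import Summits.Ventures.PercRepro.RankLevelSetLevelSevenRowThirtyEightTelForm
import Summits.Ventures.PercRepro.RankLevelSetLevelSevenRowThirtyEightTelCellsA
import Summits.Ventures.PercRepro.RankLevelSetLevelSevenRowThirtyEightLarge

/-!
# PercRepro — THE ROW `38` OF LEVEL `7` AT ITS RANK: C-025 AT `q = 7`, `p = 38`, FOR EVERY FINITE MATROID, ON THE TELESCOPING
COUNT WITH THE NULLITY SPLIT IN `k` STEPS, THE BONFERRONI CORRECTION AT LEVEL `7` AND THE SPLIT `Y`-TAIL (THE REFINED TRIANGLE COUNT `triBound8` ON THE KERNELS AT NULLITIES `4` AND `5`, THE EXACT s₄ CHAIN, T4⁺) (p8, gen 23; a feeder for S4 — the top of the `q = 7` window; the rows `≥ 39` are chained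
in RankLevelSetLevelSevenRowThirtyNineChain)

Level `7` at rank `38` by the per-rank wrapper `rls_succ_large_at 6 7 38` (p8 g0, S3SixWindow): level `6` at `37`
(`c025_six_all`) and the `e`-free core at `(38, d)` for every `d ≥ 8` — the cells `8 ≤ d ≤ 153` by their numeric forms ON
THE TELESCOPING COUNT (`tel_form38`, RankLevelSetLevelSevenRowThirtyEightTelForm: the `N`-side `nsideTel 38 d S3 S4 S5` with the
disjoint pair count and the per-level minimum of the quartic pair bound and the coloop telescoping; the nullity-capped
`Y`-tail or the count-based one, THE NULLITY SPLIT IN `k` STEPS per cell, THE BONFERRONI CORRECTION AT LEVEL `7`) through `c025_core_seven_of_form_splitky` (RankLevelSetCoreSevenOfFormSplitKY) with `hs3` from THE REFINED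
TRIANGLE COUNT `S1.ncard_triangles_le_triBound8` (S1TriangleCountBootEight: the kernels `s₃ ≤ 6` at nullity `4` and `s₃ ≤ 8` at nullity `5` with the restriction-refined step, under (C1), (C2) and (C3)), `hs4` from p1's EXACT s₄ CHAIN at `d = 8 … 13` and its continuation at `d = 14 … 20`
(`S1.ncard_fourCircuits_le_eighty_seven` … `…_one_thousand_five_hundred_twenty_one`, S1CoreCapEightExactFinal / …Chain / …ChainB — the cells
`8 ≤ d ≤ 20` carry the literal values) and from p1's T4⁺ `S1.ncard_fourCircuits_le_fourCircuitBound` (S1CoreFourCircuitSum) at `d ≥ 21`, and `hs5` from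
`S1.fortyEight_mul_ncard_five_circuits_le_sharp` (S1FiveCircuitCountSharpC), the coranks `d ≥ 154` by the large-corank
inequality at `(38, n ≥ 192)` (`largeSeven_all38`) through `c025_core_seven_large_of_ineq` (RankLevelSetCoreSevenOfForm).
* **`c025_core_seven_at_thirty_eight`** — the `e`-free core at rank `38`, every corank `d ≥ 8`;
* **`c025_seven_at_thirty_eight`** — level `7` at rank `38`, every finite matroid.
Axioms: standard.
-/

open scoped Matroid

namespace PercRepro

namespace ThmN

variable {α : Type}

/-- **The `e`-free core of level `7` at rank `38`, every corank `d ≥ 8`**: the numeric forms of the cells `(38, 8 … 153)` on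
the telescoping count with the refined triangle count, p1's exact s₄ chain (`d ≤ 20`) / T4⁺ (`d ≥ 21`) and the sharp five-circuit count, the capped tail, and the
large-corank inequality at `(38, n ≥ 192)`. -/
theorem c025_core_seven_at_thirty_eight (M : Matroid α) [M.Finite] (d : ℕ) (hd8 : 8 ≤ d) (hR : M.eRank = (38 : ℕ∞))
    (hn : M.E.ncard = 38 + d) (hfree : EFree M) : RLS M 38 7 := by
  rcases Nat.lt_or_ge d 154 with h | h
  · -- the circuit bounds: the re-based triangle count, T4⁺ and the sharp five-circuit count
    have hd : M.E.encard = M.eRank + d := by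
      rw [hR, ← M.ground_finite.cast_ncard_eq, hn]
      push_cast
      ring
    have hs : ∀ e ∈ M.E, ∀ f ∈ M.E, e ≠ f → M.eRk {e, f} = 2 := by
      intro e he f hf hef
      have h2 : (2 : ℕ∞) ≤ M.eRk {e, f} :=
        two_le_eRk_of_two_le_ncard_of_free M hfree (Set.pair_subset he hf) (by rw [Set.ncard_pair hef])
      have h3 : M.eRk {e, f} ≤ 2 := by
        have := M.eRk_le_encard {e, f}
        rwa [Set.encard_pair hef] at this
      exact le_antisymm h3 h2
    have hC1 : ∀ L ⊆ M.E, M.eRk L = 2 → L.ncard ≤ 3 :=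
      fun L hL hr => ncard_le_three_of_eRk_two M hs hfree hL hr
    have hC2 : ∀ X ⊆ M.E, M.eRk X ≤ 3 → X.ncard ≤ 6 :=
      fun X hX hr => ncard_le_six_of_eRk_le_three_of_free M hfree hX hr
    have hC3 : ∀ X ⊆ M.E, M.eRk X ≤ 4 → X.ncard ≤ 10 :=
      fun X hX hr => ncard_le_ten_of_eRk_le_four_of_free M hfree hX hr
    have hs3 : {C | M.IsCircuit C ∧ C.ncard = 3}.ncard ≤ S1.triBound8 d :=
      S1.ncard_triangles_le_triBound8 M hC1 hC2 hC3 hd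
    have hs5 : {C | M.IsCircuit C ∧ C.ncard = 5}.ncard ≤ 7 * d * (d + 1) * (d * d + d + 10) / 48 := by
      have hT5 : 48 * {C : Set α | M.IsCircuit C ∧ C.ncard = 5}.ncard ≤ 7 * d * (d + 1) * (d * d + d + 10) :=
        S1.fortyEight_mul_ncard_five_circuits_le_sharp M hC3 hd
      rw [Nat.le_div_iff_mul_le (by norm_num)]
      linarith [hT5]
    rcases Nat.lt_or_ge d 21 with h14 | h14
    · -- the coranks `8 … 20`: p1's exact s₄ chain / ChainB by name, the cells with the literal values
      interval_cases d
      · have hs3' : {C | M.IsCircuit C ∧ C.ncard = 3}.ncard ≤ 19 := by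
          have h := hs3
          rwa [S1.triBound8_val_8] at h
        have hs4 : {C | M.IsCircuit C ∧ C.ncard = 4}.ncard ≤ 87 :=
          S1.ncard_fourCircuits_le_eighty_seven M hfree hd
        exact c025_core_seven_of_form_splitky M 38 8 19 87
          (7 * 8 * (8 + 1) * (8 * 8 + 8 + 10) / 48) hd8 hR hn hfree hs3' hs4 hs5 (by norm_num) (by omega)
          tel_form38_8
      · have hs3' : {C | M.IsCircuit C ∧ C.ncard = 3}.ncard ≤ 24 := by
          have h := hs3
          rwa [S1.triBound8_val_9] at h
        have hs4 : {C | M.IsCircuit C ∧ C.ncard = 4}.ncard ≤ 121 :=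
          S1.ncard_fourCircuits_le_one_hundred_twenty_one M hfree hd
        exact c025_core_seven_of_form_splitky M 38 9 24 121
          (7 * 9 * (9 + 1) * (9 * 9 + 9 + 10) / 48) hd8 hR hn hfree hs3' hs4 hs5 (by norm_num) (by omega)
          tel_form38_9
      · have hs3' : {C | M.IsCircuit C ∧ C.ncard = 3}.ncard ≤ 30 := by
          have h := hs3
          rwa [S1.triBound8_val_10] at h
        have hs4 : {C | M.IsCircuit C ∧ C.ncard = 4}.ncard ≤ 165 :=
          S1.ncard_fourCircuits_le_one_hundred_sixty_five M hfree hd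
        exact c025_core_seven_of_form_splitky M 38 10 30 165
          (7 * 10 * (10 + 1) * (10 * 10 + 10 + 10) / 48) hd8 hR hn hfree hs3' hs4 hs5 (by norm_num) (by omega)
          tel_form38_10
      · have hs3' : {C | M.IsCircuit C ∧ C.ncard = 3}.ncard ≤ 36 := by
          have h := hs3
          rwa [S1.triBound8_val_11] at h
        have hs4 : {C | M.IsCircuit C ∧ C.ncard = 4}.ncard ≤ 220 :=
          S1.ncard_fourCircuits_le_two_hundred_twenty M hfree hd
        exact c025_core_seven_of_form_splitky M 38 11 36 220
          (7 * 11 * (11 + 1) * (11 * 11 + 11 + 10) / 48) hd8 hR hn hfree hs3' hs4 hs5 (by norm_num) (by omega)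
          tel_form38_11
      · have hs3' : {C | M.IsCircuit C ∧ C.ncard = 3}.ncard ≤ 43 := by
          have h := hs3
          rwa [S1.triBound8_val_12] at h
        have hs4 : {C | M.IsCircuit C ∧ C.ncard = 4}.ncard ≤ 287 :=
          S1.ncard_fourCircuits_le_two_hundred_eighty_seven M hfree hd
        exact c025_core_seven_of_form_splitky M 38 12 43 287
          (7 * 12 * (12 + 1) * (12 * 12 + 12 + 10) / 48) hd8 hR hn hfree hs3' hs4 hs5 (by norm_num) (by omega)
          tel_form38_12
      · have hs3' : {C | M.IsCircuit C ∧ C.ncard = 3}.ncard ≤ 51 := by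
          have h := hs3
          rwa [S1.triBound8_val_13] at h
        have hs4 : {C | M.IsCircuit C ∧ C.ncard = 4}.ncard ≤ 369 :=
          S1.ncard_fourCircuits_le_three_hundred_sixty_nine M hfree hd
        exact c025_core_seven_of_form_splitky M 38 13 51 369
          (7 * 13 * (13 + 1) * (13 * 13 + 13 + 10) / 48) hd8 hR hn hfree hs3' hs4 hs5 (by norm_num) (by omega)
          tel_form38_13
      · have hs3' : {C | M.IsCircuit C ∧ C.ncard = 3}.ncard ≤ 60 := by
          have h := hs3
          rwa [S1.triBound8_val_14] at h
        have hs4 : {C | M.IsCircuit C ∧ C.ncard = 4}.ncard ≤ 467 :=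
          S1.ncard_fourCircuits_le_four_hundred_sixty_seven M hfree hd
        exact c025_core_seven_of_form_splitky M 38 14 60 467
          (7 * 14 * (14 + 1) * (14 * 14 + 14 + 10) / 48) hd8 hR hn hfree hs3' hs4 hs5 (by norm_num) (by omega)
          tel_form38_14
      · have hs3' : {C | M.IsCircuit C ∧ C.ncard = 3}.ncard ≤ 70 := by
          have h := hs3
          rwa [S1.triBound8_val_15] at h
        have hs4 : {C | M.IsCircuit C ∧ C.ncard = 4}.ncard ≤ 583 :=
          S1.ncard_fourCircuits_le_five_hundred_eighty_three M hfree hd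
        exact c025_core_seven_of_form_splitky M 38 15 70 583
          (7 * 15 * (15 + 1) * (15 * 15 + 15 + 10) / 48) hd8 hR hn hfree hs3' hs4 hs5 (by norm_num) (by omega)
          tel_form38_15
      · have hs3' : {C | M.IsCircuit C ∧ C.ncard = 3}.ncard ≤ 80 := by
          have h := hs3
          rwa [S1.triBound8_val_16] at h
        have hs4 : {C | M.IsCircuit C ∧ C.ncard = 4}.ncard ≤ 720 :=
          S1.ncard_fourCircuits_le_seven_hundred_twenty M hfree hd
        exact c025_core_seven_of_form_splitky M 38 16 80 720
          (7 * 16 * (16 + 1) * (16 * 16 + 16 + 10) / 48) hd8 hR hn hfree hs3' hs4 hs5 (by norm_num) (by omega)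
          tel_form38_16
      · have hs3' : {C | M.IsCircuit C ∧ C.ncard = 3}.ncard ≤ 91 := by
          have h := hs3
          rwa [S1.triBound8_val_17] at h
        have hs4 : {C | M.IsCircuit C ∧ C.ncard = 4}.ncard ≤ 880 :=
          S1.ncard_fourCircuits_le_eight_hundred_eighty M hfree hd
        exact c025_core_seven_of_form_splitky M 38 17 91 880
          (7 * 17 * (17 + 1) * (17 * 17 + 17 + 10) / 48) hd8 hR hn hfree hs3' hs4 hs5 (by norm_num) (by omega)
          tel_form38_17
      · have hs3' : {C | M.IsCircuit C ∧ C.ncard = 3}.ncard ≤ 103 := by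
          have h := hs3
          rwa [S1.triBound8_val_18] at h
        have hs4 : {C | M.IsCircuit C ∧ C.ncard = 4}.ncard ≤ 1065 :=
          S1.ncard_fourCircuits_le_one_thousand_sixty_five M hfree hd
        exact c025_core_seven_of_form_splitky M 38 18 103 1065
          (7 * 18 * (18 + 1) * (18 * 18 + 18 + 10) / 48) hd8 hR hn hfree hs3' hs4 hs5 (by norm_num) (by omega)
          tel_form38_18
      · have hs3' : {C | M.IsCircuit C ∧ C.ncard = 3}.ncard ≤ 115 := by
          have h := hs3
          rwa [S1.triBound8_val_19] at h
        have hs4 : {C | M.IsCircuit C ∧ C.ncard = 4}.ncard ≤ 1278 :=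
          S1.ncard_fourCircuits_le_one_thousand_two_hundred_seventy_eight M hfree hd
        exact c025_core_seven_of_form_splitky M 38 19 115 1278
          (7 * 19 * (19 + 1) * (19 * 19 + 19 + 10) / 48) hd8 hR hn hfree hs3' hs4 hs5 (by norm_num) (by omega)
          tel_form38_19
      · have hs3' : {C | M.IsCircuit C ∧ C.ncard = 3}.ncard ≤ 128 := by
          have h := hs3
          rwa [S1.triBound8_val_20] at h
        have hs4 : {C | M.IsCircuit C ∧ C.ncard = 4}.ncard ≤ 1521 :=
          S1.ncard_fourCircuits_le_one_thousand_five_hundred_twenty_one M hfree hd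
        exact c025_core_seven_of_form_splitky M 38 20 128 1521
          (7 * 20 * (20 + 1) * (20 * 20 + 20 + 10) / 48) hd8 hR hn hfree hs3' hs4 hs5 (by norm_num) (by omega)
          tel_form38_20
    · -- the coranks `21 … 153`: T4⁺ in the S4 slot, the dispatcher
      have hs4 : {C | M.IsCircuit C ∧ C.ncard = 4}.ncard ≤ S1.fourCircuitBound d :=
        S1.ncard_fourCircuits_le_fourCircuitBound M hfree hd
      exact c025_core_seven_of_form_splitky M 38 d (S1.triBound8 d) (S1.fourCircuitBound d)
        (7 * d * (d + 1) * (d * d + d + 10) / 48) hd8 hR hn hfree hs3 hs4 hs5 (by norm_num) (by omega)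
        (tel_form38 d h14 (by omega))
  · exact c025_core_seven_large_of_ineq M 38 hR (largeSeven_all38 M.E.ncard (by omega)) hfree

/-- **Level `7` at rank `38`, every finite matroid**: `rls_succ_large_at 6 7 38` on level `6` at `37` (`c025_six_all`), the
coranks `≤ 7` (`U = ∅` or Theorem M) and the core at `38`. -/
theorem c025_seven_at_thirty_eight (M : Matroid α) [M.Finite] : RLS M 38 7 := by
  refine rls_succ_large_at (α := α) 6 7 38 (by norm_num) (fun M _ => c025_six_all M 37 (by norm_num)) ?_ ?_ M
  · -- corank `≤ 7`: `U = ∅` or Theorem M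
    intro M _ hn
    rcases Nat.lt_or_ge M.E.ncard (38 + 7) with h | h
    · exact RLS_of_ncard_lt M h
    · exact RLS_of_ncard_eq M (by omega)
  · -- the core at corank `≥ 8`
    intro M _ hR hbig hfree
    exact c025_core_seven_at_thirty_eight M (M.E.ncard - 38) (by omega) hR (by omega) hfree

end ThmN

end PercRepro
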